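import Literature.Analysis.FluidPDE.KatoRieszPressureSuitable
import HarnessLib

/-!
# The Riesz pressure of a Kato solution up to the final time: measurability, `L^{3/2}` bound, tails

Analysis/FluidPDE proof file (theorems only) on the Calderón / Rusin–Šverák route to the far-field
regularity of Kato's mild `L³` solution near the blow-up time
(`Literature.Analysis.FluidPDE.IsKatoSolutionOn.farField_bound`; W. Rusin, V. Šverák, J. Funct.
Anal. 260 (2011) = arXiv:0911.0500, §4 p. 6; P. G. Lemarié-Rieusset, *The Navier–Stokes problem
in the 21st century* (2016), Prop. 6.5 / Def. 6.9 / Prop. 6.2 and Thm. 15.1).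

The pressures of `IsKatoSolutionOn.exists_rieszPressure_suitable_slab` live on interior slabs
`(0, S) × ℝ³`, `S < T`, but their slices are, for a.e. `t`, the Riesz pressures `Π[u(t)]`. Gluing
them over an exhaustion `Sₙ ↑ T` gives one jointly measurable function `P` on `(0, T) × ℝ³` with
`P(t) = Π[u(t)]` a.e. and Stein's bound `‖P(t)‖_{3/2} ≤ C_S ‖u(t)‖₃²` for a.e. `t < T`
(`IsKatoSolutionOn.exists_measurable_rieszPressure`); hence
`∫∫ |P|^{3/2} ≤ C_S^{3/2} ∫∫ |u|³` on `(a, T) × ℝ³` (`lintegral_rieszPressure_le`), the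
space–time integrals of `|p|^{3/2}` over boxes do not depend on the chosen representative
(`setLIntegral_prod_eq_of_ae_slice_eq`), and the tails `∫∫_{(a,T) × {|x| > R}}` of an integrable
density tend to zero (`tendsto_setLIntegral_prod_compl_closedBall`).

## Mathlib / tree search

Tree: `IsKatoSolutionOn.exists_rieszPressure_suitable_slab` (`KatoRieszPressureSuitable.lean`),
`steinConstThreeHalves`, `rieszPressure` (`RieszPressureSpaceTime.lean`). Mathlib:
`preimage_find_eq_disjointed`, `aestronglyMeasurable_iUnion_iff`, `ae_restrict_iUnion_iff`,
`lintegral_prod`, `Measure.prod_restrict`, `eLpNorm_nnreal_pow_eq_lintegral`,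
`tendsto_measure_iInter_atTop`, `withDensity_apply`.

## References

* W. Rusin, V. Šverák, J. Funct. Anal. 260 (2011) 879–891 = arXiv:0911.0500, §4 p. 6.
  [RusinSverak2011]
* P. G. Lemarié-Rieusset, *The Navier–Stokes Problem in the 21st Century*, CRC Press 2016,
  Prop. 6.5, Def. 6.9, Prop. 6.2; Thm. 15.1. [LemarieRieusset2016]
-/

noncomputable section

open MeasureTheory TopologicalSpace Set Function Filter Topology Metric InnerProductSpace
open scoped ENNReal NNReal RealInnerProductSpace

namespace Literature.Analysis.FluidPDE

/-! ### Gluing slice data over an exhaustion of `(0, T)` -/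

section Glue

variable {X E : Type*} [MeasureSpace X] [NormedAddCommGroup E]

/-- **Gluing lemma.** Functions `Pₙ` on the slabs `(0, Sₙ) × X`, jointly measurable there and with
slices satisfying a property `good t (Pₙ t)` for a.e. `t < Sₙ`, glue — along the first index `n`
with `t < Sₙ` — to a function on `(0, T) × X` (`Sₙ > 0`, every `t ∈ (0, T)` below some `Sₙ`) which
is jointly measurable with `good` slices for a.e. `t < T`. [folklore] -/
theorem exists_glue_of_slices [TopologicalSpace.PseudoMetrizableSpace E]
    {S : ℕ → ℝ} {T : ℝ} (hS0 : ∀ n, 0 < S n) (hcov : ∀ t ∈ Ioo 0 T, ∃ n, t < S n)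
    {P : ℕ → ℝ → X → E} {good : ℝ → (X → E) → Prop}
    (hPm : ∀ n, AEStronglyMeasurable (uncurry (P n)) (volume.restrict (Ioo 0 (S n) ×ˢ (univ : Set X))))
    (hP : ∀ n, ∀ᵐ t ∂(volume.restrict (Ioo 0 (S n))), good t (P n t)) :
    ∃ Q : ℝ → X → E, AEStronglyMeasurable (uncurry Q) (volume.restrict (Ioo 0 T ×ˢ (univ : Set X))) ∧
      ∀ᵐ t ∂(volume.restrict (Ioo 0 T)), good t (Q t) := by
  classical
  -- the covering sets `s n = {t < Sₙ} ∪ {T ≤ t}` (total) and the first index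
  let s : ℕ → Set ℝ := fun n => Iio (S n) ∪ Ici T
  have hs : ∀ t, ∃ n, t ∈ s n := by
    intro t
    by_cases hT : T ≤ t
    · exact ⟨0, Or.inr hT⟩
    by_cases h0 : t ≤ 0
    · exact ⟨0, Or.inl (h0.trans_lt (hS0 0))⟩
    push Not at hT h0
    obtain ⟨n, hn⟩ := hcov t ⟨h0, hT⟩
    exact ⟨n, Or.inl hn⟩
  let N : ℝ → ℕ := fun t => Nat.find (hs t)
  have hNspec : ∀ t, t ∈ s (N t) := fun t => Nat.find_spec (hs t)
  have hsm : ∀ n, MeasurableSet (s n) := fun n => measurableSet_Iio.union measurableSet_Ici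
  -- the pieces `A n = N ⁻¹ {n}` are the disjointed covering sets
  have hA : ∀ n, N ⁻¹' {n} = disjointed s n := fun n => preimage_find_eq_disjointed s hs n
  have hAm : ∀ n, MeasurableSet (N ⁻¹' {n}) := fun n => by
    rw [hA]; exact MeasurableSet.disjointed hsm n
  have hAsub : ∀ n, N ⁻¹' {n} ∩ Ioo 0 T ⊆ Ioo 0 (S n) := by
    intro n t ht
    have h1 : t ∈ s (N t) := hNspec t
    have h2 : N t = n := ht.1
    rw [h2] at h1
    rcases h1 with h | h
    · exact ⟨ht.2.1, h⟩
    · exact absurd ht.2.2 (not_lt.2 h)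
  have hU : (⋃ n, N ⁻¹' {n} ∩ Ioo 0 T) = Ioo 0 T := by
    ext t
    simp only [mem_iUnion, mem_inter_iff, mem_preimage, mem_singleton_iff, exists_and_right, exists_eq', true_and]
  refine ⟨fun t => P (N t) t, ?_, ?_⟩
  · have hU' : (⋃ n, (N ⁻¹' {n} ∩ Ioo 0 T) ×ˢ (univ : Set X)) = Ioo 0 T ×ˢ (univ : Set X) := by
      rw [← iUnion_prod_const, hU]
    rw [← hU', aestronglyMeasurable_iUnion_iff]
    intro n
    have h1 : AEStronglyMeasurable (uncurry (P n)) (volume.restrict ((N ⁻¹' {n} ∩ Ioo 0 T) ×ˢ (univ : Set X))) :=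
      (hPm n).mono_measure (Measure.restrict_mono (prod_mono (hAsub n) Subset.rfl) le_rfl)
    refine h1.congr ((ae_restrict_mem (((hAm n).inter measurableSet_Ioo).prod MeasurableSet.univ)).mono
      fun z hz => ?_)
    have hz1 : N z.1 = n := hz.1.1
    show uncurry (P n) z = uncurry (fun t => P (N t) t) z
    simp only [uncurry, hz1]
  · rw [← hU, ae_restrict_iUnion_iff]
    intro n
    have h1 : ∀ᵐ t ∂(volume.restrict (N ⁻¹' {n} ∩ Ioo 0 T)), good t (P n t) :=
      ae_restrict_of_ae_restrict_of_subset (hAsub n) (hP n)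
    filter_upwards [h1, ae_restrict_mem ((hAm n).inter measurableSet_Ioo)] with t ht htm
    have h2 : N t = n := htm.1
    show good t (P (N t) t)
    rw [h2]; exact ht

end Glue

/-! ### Tonelli bookkeeping -/

section Tonelli

variable {X E : Type*} [MeasureSpace X] [SFinite (volume : Measure X)] [NormedAddCommGroup E]

/-- Space–time integrals of `‖f‖ₑ^r` over `I × B` agree for two jointly measurable functions whose
slices agree a.e. for a.e. `t ∈ I`. [folklore] -/
theorem setLIntegral_prod_eq_of_ae_slice_eq {I : Set ℝ} {f g : ℝ → X → E}
    (hf : AEStronglyMeasurable (uncurry f) (volume.restrict (I ×ˢ (univ : Set X))))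
    (hg : AEStronglyMeasurable (uncurry g) (volume.restrict (I ×ˢ (univ : Set X))))
    (hfg : ∀ᵐ t ∂(volume.restrict I), f t =ᵐ[volume] g t) (B : Set X) (r : ℝ) :
    ∫⁻ z in I ×ˢ B, ‖f z.1 z.2‖ₑ ^ r = ∫⁻ z in I ×ˢ B, ‖g z.1 z.2‖ₑ ^ r := by
  have hprod : (volume.restrict (I ×ˢ B) : Measure (ℝ × X)) = (volume.restrict I).prod (volume.restrict B) := by
    rw [show (volume : Measure (ℝ × X)) = (volume : Measure ℝ).prod volume from rfl, Measure.prod_restrict]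
  have hsub : I ×ˢ B ⊆ I ×ˢ (univ : Set X) := prod_mono Subset.rfl (subset_univ _)
  have hf' : AEMeasurable (fun z : ℝ × X => ‖f z.1 z.2‖ₑ ^ r) ((volume.restrict I).prod (volume.restrict B)) := by
    rw [← hprod]; exact ((hf.mono_measure (Measure.restrict_mono hsub le_rfl)).enorm.pow_const r)
  have hg' : AEMeasurable (fun z : ℝ × X => ‖g z.1 z.2‖ₑ ^ r) ((volume.restrict I).prod (volume.restrict B)) := by
    rw [← hprod]; exact ((hg.mono_measure (Measure.restrict_mono hsub le_rfl)).enorm.pow_const r)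
  rw [hprod, lintegral_prod _ hf', lintegral_prod _ hg']
  refine lintegral_congr_ae (hfg.mono fun t ht => ?_)
  refine lintegral_congr_ae ((ae_restrict_of_ae ht).mono fun x hx => ?_)
  show ‖f t x‖ₑ ^ r = ‖g t x‖ₑ ^ r
  rw [hx]

/-- **Tails of an integrable space–time density vanish**: if `∫∫_{I × X} F < ∞` then
`∫∫_{I × {|x| > n}} F → 0` (continuity from above of the measure with density `F`). [folklore] -/
theorem tendsto_setLIntegral_prod_compl_closedBall {Y : Type*} [MeasureSpace Y] [PseudoMetricSpace Y]
    [OpensMeasurableSpace Y] (I : Set ℝ) {F : ℝ × Y → ℝ≥0∞} (y₀ : Y)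
    (hF : ∫⁻ z in I ×ˢ (univ : Set Y), F z < ∞) :
    Tendsto (fun n : ℕ => ∫⁻ z in I ×ˢ (closedBall y₀ (n : ℝ))ᶜ, F z) atTop (𝓝 0) := by
  set μ : Measure (ℝ × Y) := (volume.restrict (I ×ˢ (univ : Set Y))).withDensity F with hμ
  set s : ℕ → Set (ℝ × Y) := fun n => (univ : Set ℝ) ×ˢ (closedBall y₀ (n : ℝ))ᶜ with hs
  have hsm : ∀ n, MeasurableSet (s n) := fun n => MeasurableSet.univ.prod measurableSet_closedBall.compl
  have hμs : ∀ n, μ (s n) = ∫⁻ z in I ×ˢ (closedBall y₀ (n : ℝ))ᶜ, F z := by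
    intro n
    rw [hμ, withDensity_apply _ (hsm n), Measure.restrict_restrict (hsm n), hs]
    congr 1
    simp only [prod_inter_prod, univ_inter, inter_univ]
  have hanti : Antitone s := fun m n hmn => prod_mono Subset.rfl (compl_subset_compl.2
    (closedBall_subset_closedBall (by exact_mod_cast hmn)))
  have hinter : (⋂ n, s n) = ∅ := by
    ext z
    simp only [mem_iInter, mem_empty_iff_false, iff_false, not_forall]
    obtain ⟨n, hn⟩ := exists_nat_ge (dist z.2 y₀)
    exact ⟨n, fun h => h.2 (mem_closedBall.2 hn)⟩
  have h0 : μ (s 0) ≠ ∞ := by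
    refine ne_top_of_le_ne_top hF.ne ?_
    rw [hμs 0]
    exact lintegral_mono_set (prod_mono Subset.rfl (subset_univ _))
  have h := tendsto_measure_iInter_atTop (μ := μ) (fun n => (hsm n).nullMeasurableSet) hanti ⟨0, h0⟩
  rw [hinter, measure_empty] at h
  simpa only [Function.comp_def, hμs] using h

end Tonelli

/-! ### The measurable Riesz pressure of a Kato solution on `(0, T)` -/

section Kato

variable {T ν : ℝ} {u₀ : EuclideanSpace ℝ (Fin 3) → EuclideanSpace ℝ (Fin 3)}
  {u : ℝ → EuclideanSpace ℝ (Fin 3) → EuclideanSpace ℝ (Fin 3)}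

/-- **A jointly measurable Riesz pressure on the whole life span** (Lemarié-Rieusset 2016,
Prop. 6.5 / Def. 6.9 / Prop. 6.2, glued over an exhaustion `Sₙ ↑ T` of `[0, T)`): for `ν > 0` and
a Kato solution `u` on `[0, T)`, `T > 0`, there is `P : ℝ → ℝ³ → ℝ`, jointly measurable on
`(0, T) × ℝ³`, with `P(t) = Π[u(t)]` a.e. and `‖P(t)‖_{3/2} ≤ C_S ‖u(t)‖₃²` for a.e. `t ∈ (0, T)`.
[cite: LemarieRieusset2016, Prop. 6.5, Def. 6.9, Prop. 6.2] -/
theorem IsKatoSolutionOn.exists_measurable_rieszPressure (hν : 0 < ν) (hu : IsKatoSolutionOn T ν u₀ u)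
    (hT : 0 < T) :
    ∃ P : ℝ → EuclideanSpace ℝ (Fin 3) → ℝ,
      AEStronglyMeasurable (uncurry P) (volume.restrict (Ioo 0 T ×ˢ (univ : Set (EuclideanSpace ℝ (Fin 3))))) ∧
      ∀ᵐ t ∂(volume.restrict (Ioo 0 T)), P t =ᵐ[volume] rieszPressure (u t) ∧
        eLpNorm (P t) (3 / 2 : ℝ≥0∞) volume ≤ steinConstThreeHalves * eLpNorm (u t) 3 volume ^ 2 := by
  set S : ℕ → ℝ := fun n => T * (((n : ℝ) + 1) / ((n : ℝ) + 2)) with hS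
  have hS0 : ∀ n, 0 < S n := fun n => by positivity
  have hST : ∀ n, S n < T := fun n => by
    rw [hS]; dsimp only
    have : ((n : ℝ) + 1) / ((n : ℝ) + 2) < 1 := by rw [div_lt_one (by positivity)]; linarith
    nlinarith
  have hcov : ∀ t ∈ Ioo 0 T, ∃ n, t < S n := by
    intro t ht
    obtain ⟨n, hn⟩ := exists_nat_gt (t / (T - t))
    refine ⟨n, ?_⟩
    rw [hS]; dsimp only
    rw [div_lt_iff₀ (by linarith [ht.2])] at hn
    rw [mul_div_assoc', lt_div_iff₀ (by positivity)]
    nlinarith [ht.1, ht.2]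
  choose p hpm _ hsl _ _ using fun n => hu.exists_rieszPressure_suitable_slab hν (hS0 n) (hST n)
  obtain ⟨Q, hQm, hQ⟩ := exists_glue_of_slices (X := EuclideanSpace ℝ (Fin 3)) (E := ℝ) hS0 hcov
    (good := fun t f => f =ᵐ[volume] rieszPressure (u t) ∧
      eLpNorm f (3 / 2 : ℝ≥0∞) volume ≤ steinConstThreeHalves * eLpNorm (u t) 3 volume ^ 2)
    hpm (fun n => (hsl n).mono fun t ht => ⟨ht.1, ht.2.2⟩)
  exact ⟨Q, hQm, hQ⟩

/-- **`L^{3/2}` bound of the glued Riesz pressure** (Stein's bound integrated in time): for `P` as in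
`IsKatoSolutionOn.exists_measurable_rieszPressure` and `0 ≤ a`,
`∫∫_{(a,T) × ℝ³} |P|^{3/2} ≤ C_S^{3/2} ∫∫_{(a,T) × ℝ³} |u|³`. [cite: LemarieRieusset2016, Prop. 6.2] -/
theorem lintegral_rieszPressure_le {P : ℝ → EuclideanSpace ℝ (Fin 3) → ℝ} (hu : IsKatoSolutionOn T ν u₀ u)
    (hPm : AEStronglyMeasurable (uncurry P) (volume.restrict (Ioo 0 T ×ˢ (univ : Set (EuclideanSpace ℝ (Fin 3))))))
    (hP : ∀ᵐ t ∂(volume.restrict (Ioo 0 T)),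
      eLpNorm (P t) (3 / 2 : ℝ≥0∞) volume ≤ steinConstThreeHalves * eLpNorm (u t) 3 volume ^ 2)
    {a : ℝ} (ha : 0 ≤ a) :
    ∫⁻ z in Ioo a T ×ˢ (univ : Set (EuclideanSpace ℝ (Fin 3))), ‖P z.1 z.2‖ₑ ^ (3 / 2 : ℝ) ≤
      (steinConstThreeHalves : ℝ≥0∞) ^ (3 / 2 : ℝ) *
        ∫⁻ z in Ioo a T ×ˢ (univ : Set (EuclideanSpace ℝ (Fin 3))), ‖u z.1 z.2‖ₑ ^ (3 : ℝ) := by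
  have hsub : Ioo a T ×ˢ (univ : Set (EuclideanSpace ℝ (Fin 3))) ⊆ Ioo 0 T ×ˢ univ :=
    prod_mono (Ioo_subset_Ioo_left ha) Subset.rfl
  have hprod : (volume.restrict (Ioo a T ×ˢ (univ : Set (EuclideanSpace ℝ (Fin 3)))) :
      Measure (ℝ × EuclideanSpace ℝ (Fin 3))) = (volume.restrict (Ioo a T)).prod volume := by
    rw [show (volume : Measure (ℝ × EuclideanSpace ℝ (Fin 3))) = (volume : Measure ℝ).prod volume from rfl,
      ← Measure.prod_restrict, Measure.restrict_univ]
  have hPm' : AEMeasurable (fun z : ℝ × EuclideanSpace ℝ (Fin 3) => ‖P z.1 z.2‖ₑ ^ (3 / 2 : ℝ))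
      ((volume.restrict (Ioo a T)).prod volume) := by
    rw [← hprod]; exact (hPm.mono_measure (Measure.restrict_mono hsub le_rfl)).enorm.pow_const _
  have hum' : AEMeasurable (fun z : ℝ × EuclideanSpace ℝ (Fin 3) => ‖u z.1 z.2‖ₑ ^ (3 : ℝ))
      ((volume.restrict (Ioo a T)).prod volume) := by
    rw [← hprod]
    exact (hu.aestronglyMeasurable.mono_measure (Measure.restrict_mono hsub le_rfl)).enorm.pow_const _
  rw [hprod, lintegral_prod _ hPm', lintegral_prod _ hum', ← lintegral_const_mul'' _ (hum'.lintegral_prod_right')]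
  refine lintegral_mono_ae ((ae_restrict_of_ae_restrict_of_subset (Ioo_subset_Ioo_left ha) hP).mono
    fun t ht => ?_)
  -- slice: `∫ |P t|^{3/2} = ‖P t‖_{3/2}^{3/2} ≤ (C ‖u t‖₃²)^{3/2} = C^{3/2} ∫ |u t|³`
  have e1 : (∫⁻ x, ‖P t x‖ₑ ^ (3 / 2 : ℝ)) = eLpNorm (P t) (3 / 2 : ℝ≥0∞) volume ^ (3 / 2 : ℝ) := by
    have h := eLpNorm_nnreal_pow_eq_lintegral (f := P t) (μ := volume) (p := (3 / 2 : ℝ≥0)) (by norm_num)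
    have e : ((3 / 2 : ℝ≥0) : ℝ) = 3 / 2 := by norm_num
    have e' : ((3 / 2 : ℝ≥0) : ℝ≥0∞) = 3 / 2 := by
      rw [ENNReal.coe_div (by norm_num)]; norm_num
    rw [e, e'] at h
    exact h.symm
  have e2 : (∫⁻ x, ‖u t x‖ₑ ^ (3 : ℝ)) = eLpNorm (u t) 3 volume ^ (3 : ℝ) := by
    have h := eLpNorm_nnreal_pow_eq_lintegral (f := u t) (μ := volume) (p := (3 : ℝ≥0)) (by norm_num)
    have e : ((3 : ℝ≥0) : ℝ) = 3 := by norm_num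
    have e' : ((3 : ℝ≥0) : ℝ≥0∞) = 3 := by norm_num
    rw [e, e'] at h
    exact h.symm
  show (∫⁻ x, ‖P t x‖ₑ ^ (3 / 2 : ℝ)) ≤ (steinConstThreeHalves : ℝ≥0∞) ^ (3 / 2 : ℝ) * ∫⁻ x, ‖u t x‖ₑ ^ (3 : ℝ)
  rw [e1, e2]
  calc eLpNorm (P t) (3 / 2 : ℝ≥0∞) volume ^ (3 / 2 : ℝ)
      ≤ ((steinConstThreeHalves : ℝ≥0∞) * eLpNorm (u t) 3 volume ^ 2) ^ (3 / 2 : ℝ) :=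
        ENNReal.rpow_le_rpow ht (by norm_num)
    _ = (steinConstThreeHalves : ℝ≥0∞) ^ (3 / 2 : ℝ) * eLpNorm (u t) 3 volume ^ (3 : ℝ) := by
        rw [ENNReal.mul_rpow_of_nonneg _ _ (by norm_num), ← ENNReal.rpow_two, ← ENNReal.rpow_mul]
        norm_num

end Kato

end Literature.Analysis.FluidPDE

end
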